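import Summits.QuantumFields.YangMills.Theorems.DiagonalMirrorRPRWilsonDiagonalModelNatKernel

/-!
# Crux `DiagonalMirrorRPR` (stmt-QuantumFields-10604), line `sign-twisted-diagonal-trace`, construction F1_diag
# (director-ym O4 WORD 3 (A)), operator layer, step S2″: the lifted kernel is SQUARE INTEGRABLE on
# `(ℕ × half layer, counting ⊗ Haar)²` — the hypothesis of the tree's `L²`-kernel Hilbert–Schmidt package

Helper for the crux `DiagonalMirrorRPR` of `YangMills` (routes `IsotropyFromPowerCounting`, `MirrorModularBoosts`,
`PencilRigidity`; item stmt-QuantumFields-10604), attached `--supports … --as helper`; it closes nothing by itself.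
Continuation of `…WilsonDiagonalModelNatKernel` (`natKernel ρ β`, symmetric, pointwise dominated).

* `sq_integral_le_integral_sq` (Jensen on the half-layer probability space), `exists_sq_natKernel_le`
  (`𝔞² ≤ C ∫ ψ_k(w(ΘY))² ψ_{k′}(w(Y))² dY`), `exists_abs_bondVec_le`, `exists_tsum_natFeature_sq_le`
  (`Σ_k ψ_k(w(Y))² = exp(β|w(Y)|²) ≤ E` uniformly), `tsum_tsum_lintegral_natFeature_sq_le` (Tonelli:
  `Σ_k Σ_{k′} ∫ ψ_k(ΘY)² ψ_{k′}(Y)² dY ≤ E²`);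
* `continuous_oddActionU`, `continuous_natKernel` (dominated convergence in the in-slab layers), `measurable_natKernel`
  (countable discrete factor); `liftMeasure S G = count ⊗ halfHaar`, `pairMass`, `exists_tsum_tsum_pairMass_le`,
  `exists_ofReal_natKernel_sq_le`;
* ★ **`lintegral_natKernel_sq_lt_top`**: `∫⁻ ofReal(𝔞²) d(ν ⊗ ν) < ∞`, `ν = liftMeasure S G`, for `β ≥ 0` and continuous `ρ`.

With `natKernel_symm` and `measurable_natKernel` this is exactly the input of
`Literature/Analysis/OperatorTheory/L2KernelIntegralOperator.exists_l2KernelOp_package` (bounded, compact, self-adjoint operator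
`𝔄` on `L²(ν)`), `…/CompactSelfAdjointEigenbasis` (real eigen-data), `…/L2KernelHilbertSchmidt` (`Σ λ_j² = ∫|𝔞|² < ∞`) — the
next file (OWED), followed by the trace formulas `Σ λ_j^m = diagCyclicTraceU ρ β m` and the pairing layer.  HONEST FRAMING: a
construction helper; no `def wilsonDiagonalModel`; nothing about D_old ⟨10604⟩, the RP crux of the FOLD restate, or the
summit is proved; the Yang–Mills mass gap is NOT proved here or anywhere in the tree.

References: M. Reed, B. Simon, *Methods of Modern Mathematical Physics I* (1980) Thm VI.22–23.
-/

set_option autoImplicit false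

noncomputable section

open MeasureTheory
open Literature.MathematicalPhysics.QuantumLattice Literature.MathematicalPhysics.QuantumFieldTheory
open Summit.QuantumFields.YangMills.Cruxes.DiagonalMirrorRPR.ParityBridgeColdTraces

namespace Summit.QuantumFields.YangMills.Cruxes.DiagonalMirrorRPR.SignTwistedDiagonalTrace.WilsonDiagonal

section NatKernelL2

variable {S : ℕ} [NeZero S] {G : Type*} [Group G] {Nc : ℕ} (ρ : G →* Matrix (Fin Nc) (Fin Nc) ℂ)
variable [TopologicalSpace G] [IsTopologicalGroup G] [CompactSpace G] [MeasurableSpace G] [BorelSpace G]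
  [SecondCountableTopology G]

/-! ### Jensen and the square bound -/

/-- Jensen on the half-layer probability space: `(∫ f)² ≤ ∫ f²` for a continuous `f`. -/
theorem sq_integral_le_integral_sq {f : HalfCfg S S G → ℝ} (hf : Continuous f) :
    (∫ Y, f Y ∂(halfHaar S G)) ^ 2 ≤ ∫ Y, f Y ^ 2 ∂(halfHaar S G) := by
  haveI : IsProbabilityMeasure (halfHaar S G) := by unfold halfHaar; infer_instance
  have h := ConvexOn.map_integral_le (μ := halfHaar S G) (f := f) (g := fun x : ℝ => x ^ 2) (s := Set.univ)
    (Even.convexOn_pow (n := 2) even_two) (by fun_prop) isClosed_univ (ae_of_all _ fun _ => Set.mem_univ _)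
    (integrable_of_continuous_halfHaar hf) (integrable_of_continuous_halfHaar (hf.pow 2))
  simpa using h

/-- **Square domination of the ℕ-indexed kernel**: `𝔞((k,X),(k′,X′))² ≤ C² ∫ ψ_k(w(ΘY))² ψ_{k′}(w(Y))² dY`. -/
theorem exists_sq_natKernel_le (hρ : Continuous ρ) (β : ℝ) :
    ∃ C : ℝ, 0 < C ∧ ∀ a b : ℕ × HalfCfg S S G,
      natKernel ρ β a b ^ 2 ≤ C * ∫ Y, natFeature (p := featDim S Nc) β a.1 (bondVec ρ (thetaHalf Y)) ^ 2 *
        natFeature (p := featDim S Nc) β b.1 (bondVec ρ Y) ^ 2 ∂(halfHaar S G) := by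
  obtain ⟨C, hC, hle⟩ := exists_abs_natKernel_le (S := S) ρ hρ β
  refine ⟨C ^ 2, by positivity, fun a b => ?_⟩
  have hcu : Continuous fun Y : HalfCfg S S G => natFeature (p := featDim S Nc) β a.1 (bondVec ρ (thetaHalf Y)) :=
    (continuous_natFeature_bondVec ρ hρ β a.1).comp continuous_thetaHalf
  have hcv : Continuous fun Y : HalfCfg S S G => natFeature (p := featDim S Nc) β b.1 (bondVec ρ Y) :=
    continuous_natFeature_bondVec ρ hρ β b.1
  have h1 := hle a b
  have hI0 : 0 ≤ ∫ Y, |natFeature (p := featDim S Nc) β a.1 (bondVec ρ (thetaHalf Y))| *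
      |natFeature (p := featDim S Nc) β b.1 (bondVec ρ Y)| ∂(halfHaar S G) :=
    integral_nonneg fun Y => mul_nonneg (abs_nonneg _) (abs_nonneg _)
  have hJ0 := sq_integral_le_integral_sq (S := S) (G := G)
    (f := fun Y => |natFeature (p := featDim S Nc) β a.1 (bondVec ρ (thetaHalf Y))| *
      |natFeature (p := featDim S Nc) β b.1 (bondVec ρ Y)|) (hcu.abs.mul hcv.abs)
  have hJ : (∫ Y, |natFeature (p := featDim S Nc) β a.1 (bondVec ρ (thetaHalf Y))| *
      |natFeature (p := featDim S Nc) β b.1 (bondVec ρ Y)| ∂(halfHaar S G)) ^ 2 ≤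
      ∫ Y, natFeature (p := featDim S Nc) β a.1 (bondVec ρ (thetaHalf Y)) ^ 2 *
        natFeature (p := featDim S Nc) β b.1 (bondVec ρ Y) ^ 2 ∂(halfHaar S G) := by
    refine hJ0.trans (le_of_eq (integral_congr_ae (ae_of_all _ fun Y => ?_)))
    dsimp only
    rw [mul_pow, sq_abs, sq_abs]
  calc natKernel ρ β a b ^ 2 = |natKernel ρ β a b| ^ 2 := (sq_abs _).symm
    _ ≤ (C * ∫ Y, |natFeature (p := featDim S Nc) β a.1 (bondVec ρ (thetaHalf Y))| *
          |natFeature (p := featDim S Nc) β b.1 (bondVec ρ Y)| ∂(halfHaar S G)) ^ 2 :=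
        pow_le_pow_left₀ (abs_nonneg _) h1 2
    _ = C ^ 2 * (∫ Y, |natFeature (p := featDim S Nc) β a.1 (bondVec ρ (thetaHalf Y))| *
          |natFeature (p := featDim S Nc) β b.1 (bondVec ρ Y)| ∂(halfHaar S G)) ^ 2 := by ring
    _ ≤ C ^ 2 * ∫ Y, natFeature (p := featDim S Nc) β a.1 (bondVec ρ (thetaHalf Y)) ^ 2 *
          natFeature (p := featDim S Nc) β b.1 (bondVec ρ Y) ^ 2 ∂(halfHaar S G) :=
        mul_le_mul_of_nonneg_left hJ (by positivity)

/-! ### The total feature mass is uniformly bounded -/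

omit [MeasurableSpace G] [BorelSpace G] [SecondCountableTopology G] in
/-- The feature vectors are uniformly bounded (continuity on a compact group). -/
theorem exists_abs_bondVec_le (hρ : Continuous ρ) : ∃ M : ℝ, ∀ (Y : HalfCfg S S G) (j : Fin (featDim S Nc)), |bondVec ρ Y j| ≤ M := by
  have hc : ∀ j : Fin (featDim S Nc), Continuous fun Y : HalfCfg S S G => |bondVec ρ Y j| := fun j =>
    ((continuous_apply j).comp (continuous_bondVec (S := S) ρ hρ)).abs
  have hb : ∀ j : Fin (featDim S Nc), BddAbove (Set.range fun Y : HalfCfg S S G => |bondVec ρ Y j|) := fun j =>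
    (isCompact_range (hc j)).bddAbove
  refine ⟨∑ j, sSup (Set.range fun Y : HalfCfg S S G => |bondVec ρ Y j|), fun Y j => ?_⟩
  have h0 : ∀ j', 0 ≤ sSup (Set.range fun Y : HalfCfg S S G => |bondVec ρ Y j'|) := fun j' =>
    (abs_nonneg _).trans (le_csSup (hb j') ⟨Y, rfl⟩)
  exact (le_csSup (hb j) ⟨Y, rfl⟩).trans
    (Finset.single_le_sum (f := fun j' => sSup (Set.range fun Y : HalfCfg S S G => |bondVec ρ Y j'|))
      (fun j' _ => h0 j') (Finset.mem_univ j))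

omit [MeasurableSpace G] [BorelSpace G] [SecondCountableTopology G] in
/-- `Σ_k ψ_k(w(Y))² ≤ exp(β p M²)` uniformly in the half layer `Y` (`β ≥ 0`). -/
theorem exists_tsum_natFeature_sq_le (hρ : Continuous ρ) {β : ℝ} (hβ : 0 ≤ β) :
    ∃ E : ℝ, 0 < E ∧ ∀ Y : HalfCfg S S G,
      HasSum (fun k : ℕ => natFeature (p := featDim S Nc) β k (bondVec ρ Y) ^ 2)
        (Real.exp (β * ∑ j, bondVec ρ Y j ^ 2)) ∧ Real.exp (β * ∑ j, bondVec ρ Y j ^ 2) ≤ E := by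
  obtain ⟨M, hM⟩ := exists_abs_bondVec_le (S := S) ρ hρ
  refine ⟨Real.exp (β * (featDim S Nc * M ^ 2)), Real.exp_pos _, fun Y => ⟨hasSum_natFeature_sq hβ _, ?_⟩⟩
  refine Real.exp_le_exp.2 (mul_le_mul_of_nonneg_left ?_ hβ)
  calc ∑ j, bondVec ρ Y j ^ 2 ≤ ∑ _j : Fin (featDim S Nc), M ^ 2 := Finset.sum_le_sum fun j _ => by
        rw [← sq_abs]; exact pow_le_pow_left₀ (abs_nonneg _) (hM Y j) 2
    _ = featDim S Nc * M ^ 2 := by simp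

/-! ### Square integrability of the ℕ-indexed kernel (Tonelli over the feature sums) -/

/-- The double feature sum of the dominating integrals is finite:
`Σ_k Σ_{k′} ∫ ψ_k(w(ΘY))² ψ_{k′}(w(Y))² dY ≤ E²` (as extended non-negative reals). -/
theorem tsum_tsum_lintegral_natFeature_sq_le (hρ : Continuous ρ) {β : ℝ} (hβ : 0 ≤ β) :
    ∃ E : ℝ, 0 < E ∧
      ∑' k : ℕ, ∑' k' : ℕ, ∫⁻ Y, ENNReal.ofReal (natFeature (p := featDim S Nc) β k (bondVec ρ (thetaHalf Y)) ^ 2 *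
          natFeature (p := featDim S Nc) β k' (bondVec ρ Y) ^ 2) ∂(halfHaar S G) ≤ ENNReal.ofReal (E * E) := by
  haveI : IsProbabilityMeasure (halfHaar S G) := by unfold halfHaar; infer_instance
  obtain ⟨E, hE, hsum⟩ := exists_tsum_natFeature_sq_le (S := S) ρ hρ hβ
  refine ⟨E, hE, ?_⟩
  -- pointwise: the double sum of the integrand is the product of the two total masses
  have hmeas : ∀ k : ℕ, Measurable fun Y : HalfCfg S S G =>
      ENNReal.ofReal (natFeature (p := featDim S Nc) β k (bondVec ρ Y) ^ 2) := fun k =>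
    ENNReal.measurable_ofReal.comp ((continuous_natFeature_bondVec ρ hρ β k).pow 2).measurable
  have hmeasΘ : ∀ k : ℕ, Measurable fun Y : HalfCfg S S G =>
      ENNReal.ofReal (natFeature (p := featDim S Nc) β k (bondVec ρ (thetaHalf Y)) ^ 2) := fun k =>
    (hmeas k).comp continuous_thetaHalf.measurable
  have hpt : ∀ Y : HalfCfg S S G,
      ∑' k : ℕ, ∑' k' : ℕ, ENNReal.ofReal (natFeature (p := featDim S Nc) β k (bondVec ρ (thetaHalf Y)) ^ 2 *
          natFeature (p := featDim S Nc) β k' (bondVec ρ Y) ^ 2) ≤ ENNReal.ofReal (E * E) := by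
    intro Y
    have hA := (hsum (thetaHalf Y)).1
    have hB := (hsum Y).1
    have hAt : ∑' k : ℕ, ENNReal.ofReal (natFeature (p := featDim S Nc) β k (bondVec ρ (thetaHalf Y)) ^ 2) =
        ENNReal.ofReal (Real.exp (β * ∑ j, bondVec ρ (thetaHalf Y) j ^ 2)) := by
      rw [← hA.tsum_eq, ENNReal.ofReal_tsum_of_nonneg (fun k => sq_nonneg _) hA.summable]
    have hBt : ∑' k : ℕ, ENNReal.ofReal (natFeature (p := featDim S Nc) β k (bondVec ρ Y) ^ 2) =
        ENNReal.ofReal (Real.exp (β * ∑ j, bondVec ρ Y j ^ 2)) := by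
      rw [← hB.tsum_eq, ENNReal.ofReal_tsum_of_nonneg (fun k => sq_nonneg _) hB.summable]
    simp only [ENNReal.ofReal_mul (sq_nonneg _)]
    simp only [ENNReal.tsum_mul_left, ENNReal.tsum_mul_right]
    rw [hAt, hBt, ← ENNReal.ofReal_mul (Real.exp_pos _).le]
    exact ENNReal.ofReal_le_ofReal (mul_le_mul (hsum _).2 (hsum _).2 (Real.exp_pos _).le hE.le)
  -- Tonelli
  have hswap : ∑' k : ℕ, ∑' k' : ℕ, ∫⁻ Y, ENNReal.ofReal (natFeature (p := featDim S Nc) β k (bondVec ρ (thetaHalf Y)) ^ 2 *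
        natFeature (p := featDim S Nc) β k' (bondVec ρ Y) ^ 2) ∂(halfHaar S G) =
      ∫⁻ Y, ∑' k : ℕ, ∑' k' : ℕ, ENNReal.ofReal (natFeature (p := featDim S Nc) β k (bondVec ρ (thetaHalf Y)) ^ 2 *
        natFeature (p := featDim S Nc) β k' (bondVec ρ Y) ^ 2) ∂(halfHaar S G) := by
    have hmk : ∀ k k' : ℕ, Measurable fun Y : HalfCfg S S G =>
        ENNReal.ofReal (natFeature (p := featDim S Nc) β k (bondVec ρ (thetaHalf Y)) ^ 2 *
          natFeature (p := featDim S Nc) β k' (bondVec ρ Y) ^ 2) := fun k k' =>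
      ENNReal.measurable_ofReal.comp
        ((((continuous_natFeature_bondVec ρ hρ β k).comp continuous_thetaHalf).pow 2).mul
          ((continuous_natFeature_bondVec ρ hρ β k').pow 2)).measurable
    rw [lintegral_tsum fun k => (Measurable.tsum fun k' => hmk k k').aemeasurable]
    refine tsum_congr fun k => ?_
    rw [lintegral_tsum fun k' => (hmk k k').aemeasurable]
  rw [hswap]
  calc ∫⁻ Y, ∑' k : ℕ, ∑' k' : ℕ, ENNReal.ofReal (natFeature (p := featDim S Nc) β k (bondVec ρ (thetaHalf Y)) ^ 2 *
          natFeature (p := featDim S Nc) β k' (bondVec ρ Y) ^ 2) ∂(halfHaar S G)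
      ≤ ∫⁻ _Y, ENNReal.ofReal (E * E) ∂(halfHaar S G) := lintegral_mono fun Y => hpt Y
    _ = ENNReal.ofReal (E * E) := by rw [lintegral_const, measure_univ, mul_one]

/-! ### Measurability of the ℕ-indexed kernel -/

omit [CompactSpace G] [MeasurableSpace G] [BorelSpace G] [SecondCountableTopology G] in
/-- The odd half step is jointly continuous in its three half layers. -/
theorem continuous_oddActionU (hρ : Continuous ρ) :
    Continuous fun t : HalfCfg S S G × HalfCfg S S G × HalfCfg S S G => oddActionU ρ t.1 t.2.1 t.2.2 := by
  unfold oddActionU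
  refine continuous_finsetSum _ fun s _ => ?_
  have h : ∀ f : HalfCfg S S G × HalfCfg S S G × HalfCfg S S G → G, Continuous f →
      Continuous fun t => (ρ (f t)).trace.re := fun f hf =>
    Complex.continuous_re.comp (Continuous.matrix_trace (hρ.comp hf))
  exact (((h _ (by fun_prop)).add (h _ (by fun_prop))).add (h _ (by fun_prop))).add (h _ (by fun_prop))

/-- For fixed feature indices the kernel is a continuous function of the two in-slab half layers (dominated convergence). -/
theorem continuous_natKernel (hρ : Continuous ρ) (β : ℝ) (k k' : ℕ) :
    Continuous fun XX' : HalfCfg S S G × HalfCfg S S G => natKernel ρ β (k, XX'.1) (k', XX'.2) := by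
  haveI : IsFiniteMeasure (halfHaar S G) := by unfold halfHaar; infer_instance
  obtain ⟨Co, hCo, hodd⟩ := exists_exp_oddActionU_le (S := S) ρ hρ β
  have hu : Continuous fun Y : HalfCfg S S G => natFeature (p := featDim S Nc) β k (bondVec ρ (thetaHalf Y)) :=
    (continuous_natFeature_bondVec ρ hρ β k).comp continuous_thetaHalf
  have hv : Continuous fun Y : HalfCfg S S G => natFeature (p := featDim S Nc) β k' (bondVec ρ Y) :=
    continuous_natFeature_bondVec ρ hρ β k'
  have hins : Continuous fun X : HalfCfg S S G => Real.exp (β / 2 * inslabAction ρ X) := by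
    refine Real.continuous_exp.comp (continuous_const.mul ?_)
    unfold inslabAction
    refine continuous_finsetSum _ fun s _ => Complex.continuous_re.comp (Continuous.matrix_trace (hρ.comp ?_))
    fun_prop
  have hI : Continuous fun XX' : HalfCfg S S G × HalfCfg S S G =>
      ∫ Y, natFeature (p := featDim S Nc) β k (bondVec ρ (thetaHalf Y)) * Real.exp (β * oddActionU ρ XX'.1 Y XX'.2) *
        natFeature (p := featDim S Nc) β k' (bondVec ρ Y) ∂(halfHaar S G) := by
    refine continuous_of_dominated (bound := fun Y => |natFeature (p := featDim S Nc) β k (bondVec ρ (thetaHalf Y))| * Co *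
      |natFeature (p := featDim S Nc) β k' (bondVec ρ Y)|) (fun XX' => ?_) (fun XX' => ae_of_all _ fun Y => ?_) ?_
      (ae_of_all _ fun Y => ?_)
    · exact ((hu.mul ((Real.continuous_exp.comp (continuous_const.mul
        ((continuous_oddActionU ρ hρ).comp (by fun_prop : Continuous fun Y : HalfCfg S S G => (XX'.1, Y, XX'.2))))))).mul
          hv).measurable.aestronglyMeasurable
    · rw [Real.norm_eq_abs, abs_mul, abs_mul, abs_of_pos (Real.exp_pos _)]
      exact mul_le_mul_of_nonneg_right (mul_le_mul_of_nonneg_left (hodd _ _ _) (abs_nonneg _)) (abs_nonneg _)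
    · exact integrable_of_continuous_halfHaar ((hu.abs.mul continuous_const).mul hv.abs)
    · exact (continuous_const.mul (Real.continuous_exp.comp (continuous_const.mul
        ((continuous_oddActionU ρ hρ).comp (by fun_prop : Continuous fun XX' : HalfCfg S S G × HalfCfg S S G =>
          (XX'.1, Y, XX'.2)))))).mul continuous_const
  unfold natKernel
  exact ((hins.comp continuous_fst).mul (hins.comp continuous_snd)).mul hI

/-- The ℕ-indexed kernel is jointly measurable on `(ℕ × HalfCfg) × (ℕ × HalfCfg)` (countable discrete factor, continuity in
the continuous factor). -/
theorem measurable_natKernel (hρ : Continuous ρ) (β : ℝ) :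
    Measurable fun z : (ℕ × HalfCfg S S G) × (ℕ × HalfCfg S S G) => natKernel ρ β z.1 z.2 := by
  -- the kernel as a function of ((X, X′), (k, k′)), countable second factor
  have hg : Measurable fun q : (HalfCfg S S G × HalfCfg S S G) × (ℕ × ℕ) => natKernel ρ β (q.2.1, q.1.1) (q.2.2, q.1.2) := by
    refine measurable_from_prod_countable_left fun kk' => ?_
    dsimp only
    exact (continuous_natKernel ρ hρ β kk'.1 kk'.2).measurable
  have he : Measurable fun z : (ℕ × HalfCfg S S G) × (ℕ × HalfCfg S S G) => ((z.1.2, z.2.2), (z.1.1, z.2.1)) :=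
    (measurable_fst.snd.prodMk measurable_snd.snd).prodMk (measurable_fst.fst.prodMk measurable_snd.fst)
  have hcomp := hg.comp he
  simpa only [Function.comp_def] using hcomp

/-! ### ★ The ℕ-indexed kernel is square integrable for `counting ⊗ halfHaar` -/

variable (S G) in
/-- The measure of the lifted configuration space `ℕ × (in-slab half layer)`: counting measure on the feature index times
the half-layer Haar probability measure (s-finite). -/
def liftMeasure : Measure (ℕ × HalfCfg S S G) := (Measure.count : Measure ℕ).prod (halfHaar S G)

/-- The dominating double sequence `∫ ψ_k(w(ΘY))² ψ_{k′}(w(Y))² dY` (extended non-negative reals). -/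
def pairMass (β : ℝ) (k k' : ℕ) : ENNReal :=
  ∫⁻ Y, ENNReal.ofReal (natFeature (p := featDim S Nc) β k (bondVec ρ (thetaHalf Y)) ^ 2 *
    natFeature (p := featDim S Nc) β k' (bondVec ρ Y) ^ 2) ∂(halfHaar S G)

/-- The dominating double sequence is summable with total mass `≤ E²`. -/
theorem exists_tsum_tsum_pairMass_le (hρ : Continuous ρ) {β : ℝ} (hβ : 0 ≤ β) :
    ∃ E : ℝ, 0 < E ∧ ∑' k : ℕ, ∑' k' : ℕ, pairMass (S := S) ρ β k k' ≤ ENNReal.ofReal (E * E) :=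
  tsum_tsum_lintegral_natFeature_sq_le ρ hρ hβ

/-- Pointwise domination in extended non-negative reals: `ofReal(𝔞((k,X),(k′,X′))²) ≤ ofReal C · pairMass k k′`. -/
theorem exists_ofReal_natKernel_sq_le (hρ : Continuous ρ) (β : ℝ) :
    ∃ C : ℝ, 0 < C ∧ ∀ (k k' : ℕ) (X X' : HalfCfg S S G),
      ENNReal.ofReal (natKernel ρ β (k, X) (k', X') ^ 2) ≤ ENNReal.ofReal C * pairMass (S := S) ρ β k k' := by
  obtain ⟨C, hC, hsq⟩ := exists_sq_natKernel_le (S := S) ρ hρ β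
  refine ⟨C, hC, fun k k' X X' => ?_⟩
  have hcont : Continuous fun Y : HalfCfg S S G => natFeature (p := featDim S Nc) β k (bondVec ρ (thetaHalf Y)) ^ 2 *
      natFeature (p := featDim S Nc) β k' (bondVec ρ Y) ^ 2 :=
    (((continuous_natFeature_bondVec ρ hρ β k).comp continuous_thetaHalf).pow 2).mul
      ((continuous_natFeature_bondVec ρ hρ β k').pow 2)
  rw [pairMass, ← ofReal_integral_eq_lintegral_ofReal (integrable_of_continuous_halfHaar hcont)
    (ae_of_all _ fun Y => mul_nonneg (sq_nonneg _) (sq_nonneg _)), ← ENNReal.ofReal_mul hC.le]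
  exact ENNReal.ofReal_le_ofReal (hsq (k, X) (k', X'))

/-- ★ **Square integrability**: `∫ |𝔞|² d(ν ⊗ ν) < ∞` for `ν = counting ⊗ halfHaar` and `β ≥ 0` — the hypothesis of the tree's
`L²`-kernel Hilbert–Schmidt package (`Literature/Analysis/OperatorTheory/L2Kernel*`), which then yields the bounded,
compact, SELF-ADJOINT (by `natKernel_symm`) operator `𝔄` with `Σ λ_j² = ∫|𝔞|² < ∞`. -/
theorem lintegral_natKernel_sq_lt_top (hρ : Continuous ρ) {β : ℝ} (hβ : 0 ≤ β) :
    ∫⁻ z, ENNReal.ofReal (natKernel ρ β z.1 z.2 ^ 2) ∂((liftMeasure S G).prod (liftMeasure S G)) < ⊤ := by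
  haveI : IsProbabilityMeasure (halfHaar S G) := by unfold halfHaar; infer_instance
  haveI : SFinite (liftMeasure S G) := by unfold liftMeasure; infer_instance
  obtain ⟨C, hC, hdom⟩ := exists_ofReal_natKernel_sq_le (S := S) ρ hρ β
  obtain ⟨E, hE, hEE⟩ := exists_tsum_tsum_pairMass_le (S := S) ρ hρ hβ
  have hF : Measurable fun z : (ℕ × HalfCfg S S G) × (ℕ × HalfCfg S S G) => ENNReal.ofReal (natKernel ρ β z.1 z.2 ^ 2) :=
    ENNReal.measurable_ofReal.comp ((measurable_natKernel (S := S) ρ hρ β).pow_const 2)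
  have hsec : ∀ a : ℕ × HalfCfg S S G, Measurable fun b : ℕ × HalfCfg S S G => ENNReal.ofReal (natKernel ρ β a b ^ 2) := by
    rintro ⟨k, X⟩
    have h1 : Measurable fun b : ℕ × HalfCfg S S G => natKernel ρ β (k, X) b := by
      refine measurable_from_prod_countable_right fun k' => ?_
      exact ((continuous_natKernel ρ hρ β k k').comp (Continuous.prodMk_right X)).measurable
    exact ENNReal.measurable_ofReal.comp (h1.pow_const 2)
  rw [lintegral_prod _ hF.aemeasurable]
  -- inner integral over `ν = count ⊗ halfHaar`
  have hinner : ∀ a : ℕ × HalfCfg S S G,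
      ∫⁻ b, ENNReal.ofReal (natKernel ρ β a b ^ 2) ∂(liftMeasure S G) ≤ ENNReal.ofReal C * ∑' k', pairMass (S := S) ρ β a.1 k' := by
    intro a
    rw [liftMeasure, lintegral_prod _ (hsec a).aemeasurable, lintegral_count, ← ENNReal.tsum_mul_left]
    refine ENNReal.tsum_le_tsum fun k' => ?_
    calc ∫⁻ X', ENNReal.ofReal (natKernel ρ β a (k', X') ^ 2) ∂(halfHaar S G)
        ≤ ∫⁻ _X', ENNReal.ofReal C * pairMass (S := S) ρ β a.1 k' ∂(halfHaar S G) :=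
          lintegral_mono fun X' => hdom a.1 k' a.2 X'
      _ = ENNReal.ofReal C * pairMass (S := S) ρ β a.1 k' := by rw [lintegral_const, measure_univ, mul_one]
  have hm : Measurable fun a : ℕ × HalfCfg S S G => ENNReal.ofReal C * ∑' k', pairMass (S := S) ρ β a.1 k' :=
    (measurable_from_top (f := fun k : ℕ => ENNReal.ofReal C * ∑' k', pairMass (S := S) ρ β k k')).comp measurable_fst
  calc ∫⁻ a, ∫⁻ b, ENNReal.ofReal (natKernel ρ β a b ^ 2) ∂(liftMeasure S G) ∂(liftMeasure S G)
      ≤ ∫⁻ a, ENNReal.ofReal C * ∑' k', pairMass (S := S) ρ β a.1 k' ∂(liftMeasure S G) := lintegral_mono fun a => hinner a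
    _ = ∑' k, ∫⁻ _X, ENNReal.ofReal C * ∑' k', pairMass (S := S) ρ β k k' ∂(halfHaar S G) := by
        rw [liftMeasure, lintegral_prod _ hm.aemeasurable, lintegral_count]
    _ = ∑' k, ENNReal.ofReal C * ∑' k', pairMass (S := S) ρ β k k' := by
        refine tsum_congr fun k => ?_
        rw [lintegral_const, measure_univ, mul_one]
    _ = ENNReal.ofReal C * ∑' k, ∑' k', pairMass (S := S) ρ β k k' := ENNReal.tsum_mul_left
    _ ≤ ENNReal.ofReal C * ENNReal.ofReal (E * E) := mul_le_mul_right hEE _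
    _ < ⊤ := ENNReal.mul_lt_top ENNReal.ofReal_lt_top ENNReal.ofReal_lt_top

end NatKernelL2

end Summit.QuantumFields.YangMills.Cruxes.DiagonalMirrorRPR.SignTwistedDiagonalTrace.WilsonDiagonal

end
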